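import Mathlib
import HarnessLib.Audit
import Summits.PneNP.PneNP.Theorems.PstarChordReadTwoGates

/-!
# Switch-gated chords: several single-partner gates per chord, all types (ROUND-24, O1 at exact tightness; memo g20 §11 residual R1)

FRONTIER range-avoidance ladder, rung F-N3, ROUND 24 (cell `pnp-ideate`, prover-2 memos `g19/O1-CHORD-READ.md` §6.10 and `g20/O1-CHORD-READ-g20.md`
§11 (residual R1: several gates on one chord's AND pair); typed target `PstarCoreBoundTargets.TerminalPeelable` (p646951); restricted-model proof
complexity — nothing here bears on `P` versus `NP`).

Generalises the capstone `PstarChordReadTwoGates.false_of_two_simpleGates` from ONE simple gate per chord to ANY NUMBER of gates per chord, provided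
every monomial on the chord's AND pair is a SWITCH GATE: a gate `(v, z)` with `v` a private of the chord and `z` an outside variable lying in no other
monomial (`z` may sit in the linear parts).  The types need not be given in advance:

* `SwitchGated I J₀ w₁ w₂ c` (def) — the AND pair of `c` carries at least one monomial of `w₁, w₂`, and every monomial touching it is a switch gate;
* `false_of_two_switchGated` — a terminal core has NO two distinct slice-generic switch-gated chords.  PROOF: if some gate on `cᵢ`'s pair and some
  gate on `cⱼ`'s pair have a `2 × 2` move determinant that is not identically zero, RANK ONE kills at a double-slice point; otherwise every gate on
  either pair has the type `λ` of a fixed gate on the other pair with `e ∈ {0, λ}` (`type_eq_of_det_zero`), so the type is UNIFORM over both pairs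
  and the type I / II / III kill of `PstarChordReadSwitch` applies (all monomials on the pairs are `Γ₂`-invisible, resp. `Γ₁`-invisible, resp.
  cancel in the sum reader).

So at tight `k = 12` the residual readings of the ≥ 5 generic chords must SHARE switch partners ((σ, z) or (z, z′) monomials) on at least four
chords (memo g20 §11, R2/R3).  No Assumption A.
-/

set_option linter.dupNamespace false -- `Summit.PneNP.PneNP.…`: summit = sub-problem name (D-0017 single-conjunct layout)

open Finset Literature.Computability.Complexity
open scoped symmDiff
open Summit.PneNP.PneNP.Theorems.PstarTyped (Typed)
open Summit.PneNP.PneNP.Theorems.PstarSALevel (varSet bdry BoundaryExpanding SimpleOverlap)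
open Summit.PneNP.PneNP.Theorems.PstarGapPeeling (not_mem_varSet_of_private)
open Summit.PneNP.PneNP.Theorems.PstarCentreFree (vars_mem_varSet)
open Summit.PneNP.PneNP.Theorems.PstarGapOneAll (gval)
open Summit.PneNP.PneNP.Theorems.PstarChordRepair (IsChord)
open Summit.PneNP.PneNP.Theorems.PstarCoreBoundTargets (Terminal)
open Summit.PneNP.PneNP.Theorems.PstarChordReadLemma (SliceGeneric)
open Summit.PneNP.PneNP.Theorems.PstarChordReadSwitch (false_of_typeI false_of_typeII false_of_typeIII false_of_independent_switches)
open Summit.PneNP.PneNP.Theorems.PstarChordReadGates (sliceGeneric_mono gval_flip_switch exists_two_slices)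
open Summit.PneNP.PneNP.Theorems.PstarChordReadTwoGates (exists_xor_not_mem_of_simpleOverlap)

namespace Summit.PneNP.PneNP.Theorems.PstarChordReadSwitches

variable {n m : ℕ}

/-- `G₁ ∆ G₂ ⊆ G₁ ∪ G₂`. -/
private theorem symmDiff_subset_union' (G₁ G₂ : Finset (Fin m)) : G₁ ∆ G₂ ⊆ G₁ ∪ G₂ := fun g hg => by
  rcases Finset.mem_symmDiff.1 hg with ⟨h, -⟩ | ⟨h, -⟩
  · exact mem_union_left _ h
  · exact mem_union_right _ h

/-- **RANK ONE ⟹ SAME TYPE**, finite form: if the `2 × 2` move determinant of two gates (types `λᵢ, λⱼ ≠ 0`, linear bits `eᵢ, eⱼ`) vanishes at all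
four values of the gated privates, then `λᵢ = λⱼ` and `eᵢ ∈ {0, λᵢ}`. -/
private theorem type_eq_of_det_zero (e₁ᵢ e₂ᵢ l₁ᵢ l₂ᵢ e₁ⱼ e₂ⱼ l₁ⱼ l₂ⱼ : Bool)
    (h : ((l₁ᵢ || l₂ᵢ) && (l₁ⱼ || l₂ⱼ)) = true ∧
      ((xor e₁ᵢ (l₁ᵢ && false)) && (xor e₂ⱼ (l₂ⱼ && false))) = ((xor e₁ⱼ (l₁ⱼ && false)) && (xor e₂ᵢ (l₂ᵢ && false))) ∧
      ((xor e₁ᵢ (l₁ᵢ && false)) && (xor e₂ⱼ (l₂ⱼ && true))) = ((xor e₁ⱼ (l₁ⱼ && true)) && (xor e₂ᵢ (l₂ᵢ && false))) ∧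
      ((xor e₁ᵢ (l₁ᵢ && true)) && (xor e₂ⱼ (l₂ⱼ && false))) = ((xor e₁ⱼ (l₁ⱼ && false)) && (xor e₂ᵢ (l₂ᵢ && true))) ∧
      ((xor e₁ᵢ (l₁ᵢ && true)) && (xor e₂ⱼ (l₂ⱼ && true))) = ((xor e₁ⱼ (l₁ⱼ && true)) && (xor e₂ᵢ (l₂ᵢ && true)))) :
    l₁ᵢ = l₁ⱼ ∧ l₂ᵢ = l₂ⱼ ∧ ((e₁ᵢ = false ∧ e₂ᵢ = false) ∨ (e₁ᵢ = l₁ᵢ ∧ e₂ᵢ = l₂ᵢ)) := by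
  obtain ⟨hl, h00, h01, h10, h11⟩ := h
  cases l₁ᵢ <;> cases l₂ᵢ <;> cases l₁ⱼ <;> cases l₂ⱼ <;> cases e₁ᵢ <;> cases e₂ᵢ <;> cases e₁ⱼ <;> cases e₂ⱼ <;> simp_all

/-! ## Switch-gated chords -/
section Defs

variable (I : LocalMap 4 n m) (J₀ : Finset (Fin m)) (w₁ w₂ : Finset (Fin n) × Finset (Fin m) × Bool) (c : Fin m)

/-- The monomial output `g` TOUCHES the AND pair of `c`. -/
def Touches (g : Fin m) : Prop :=
  ¬ ((I.vars g 2 ≠ I.vars c 2 ∧ I.vars g 3 ≠ I.vars c 2) ∧ (I.vars g 2 ≠ I.vars c 3 ∧ I.vars g 3 ≠ I.vars c 3))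

/-- `g` is a SWITCH GATE on `c` with private `v` and partner `z`: AND pair `{v, z}`, `v` a private of `c`, `z` outside the core and in no other
monomial of `w₁, w₂`. -/
def IsSwitch (g : Fin m) (v z : Fin n) : Prop :=
  (v = I.vars c 2 ∨ v = I.vars c 3) ∧ ((I.vars g 2 = v ∧ I.vars g 3 = z) ∨ (I.vars g 2 = z ∧ I.vars g 3 = v)) ∧
    (∀ j ∈ J₀, z ∉ varSet I j) ∧ (∀ g' ∈ w₁.2.1 ∪ w₂.2.1, g' ≠ g → I.vars g' 2 ≠ z ∧ I.vars g' 3 ≠ z)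

/-- The chord `c` is **SWITCH-GATED**: its AND pair carries at least one monomial of `w₁, w₂`, and every monomial touching it is a switch gate. -/
def SwitchGated : Prop :=
  (∃ g ∈ w₁.2.1 ∪ w₂.2.1, Touches I c g) ∧ ∀ g ∈ w₁.2.1 ∪ w₂.2.1, Touches I c g → ∃ v z, IsSwitch I J₀ w₁ w₂ c g v z

end Defs

section Main

variable {I : LocalMap 4 n m} {r : ℕ} {y : Fin m → Bool} {J₀ : Finset (Fin m)} {w₁ w₂ : Finset (Fin n) × Finset (Fin m) × Bool}

/-- The move of the reader `(C_k, G_k)` (`G_k ⊆ G₁ ∪ G₂`) under a switch: `[z ∈ C_k] ⊕ ([g ∈ G_k] ∧ x_v)`. -/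
private theorem flip_of_isSwitch (hI : I.IsPure xorAndPred) {c g : Fin m} {v z : Fin n} (hc : c ∈ J₀) (h : IsSwitch I J₀ w₁ w₂ c g v z)
    {C : Finset (Fin n)} {G : Finset (Fin m)} (hG : G ⊆ w₁.2.1 ∪ w₂.2.1) (x : Fin n → Bool) :
    gval I C G (Function.update x z (!x z)) = xor (gval I C G x) (xor (decide (z ∈ C)) (decide (g ∈ G) && x v)) := by
  have hvz : v ≠ z := by
    rcases h.1 with e | e <;> exact fun hvz => h.2.2.1 c hc (hvz ▸ e ▸ vars_mem_varSet I c _)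
  exact gval_flip_switch I hI hvz h.2.1 (fun g' hg' hne => h.2.2.2 g' (hG hg') hne) x

/-- A slice of `c` on which the private `v` has the prescribed value. -/
private theorem exists_slice {c : Fin m} {v : Fin n} (hv : v = I.vars c 2 ∨ v = I.vars c 3) (s : Bool) :
    ∃ π κ : Bool, ∀ x : Fin n → Bool, x (I.vars c 2) = π → x (I.vars c 3) = κ → x v = s := by
  rcases hv with e | e
  · exact ⟨s, false, fun x hp _ => by rw [e]; exact hp⟩
  · exact ⟨false, s, fun x _ hq => by rw [e]; exact hq⟩

/-- **A terminal core has no two distinct slice-generic SWITCH-GATED chords** (any number of gates per chord, any types). -/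
theorem false_of_two_switchGated (hI : I.IsPure xorAndPred) (hT : Typed I) (hS : SimpleOverlap I) (hB : BoundaryExpanding r I)
    (ht : Terminal I r y J₀ w₁ w₂) {cᵢ cⱼ : Fin m} (hcᵢ : cᵢ ∈ J₀) (hcⱼ : cⱼ ∈ J₀) (hne : cᵢ ≠ cⱼ) (hchᵢ : IsChord I J₀ cᵢ)
    (hchⱼ : IsChord I J₀ cⱼ) (hGᵢ : SwitchGated I J₀ w₁ w₂ cᵢ) (hGⱼ : SwitchGated I J₀ w₁ w₂ cⱼ)
    (hgenᵢ : SliceGeneric I y J₀ cᵢ (w₁.2.1 ∪ w₂.2.1)) (hgenⱼ : SliceGeneric I y J₀ cⱼ (w₁.2.1 ∪ w₂.2.1)) : False := by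
  classical
  have hv := exists_xor_not_mem_of_simpleOverlap hI hS hne
  obtain ⟨⟨gᵢ, hgᵢ, htᵢ⟩, hallᵢ⟩ := hGᵢ
  obtain ⟨⟨gⱼ, hgⱼ, htⱼ⟩, hallⱼ⟩ := hGⱼ
  obtain ⟨vᵢ, zᵢ, hSᵢ⟩ := hallᵢ gᵢ hgᵢ htᵢ
  obtain ⟨vⱼ, zⱼ, hSⱼ⟩ := hallⱼ gⱼ hgⱼ htⱼ
  -- variables of one chord's switches versus the other chord
  have hvmemᵢ : ∀ {g v z}, IsSwitch I J₀ w₁ w₂ cᵢ g v z → v ∈ varSet I cᵢ := fun h => by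
    rcases h.1 with e | e <;> rw [e] <;> exact vars_mem_varSet I cᵢ _
  have hvmemⱼ : ∀ {g v z}, IsSwitch I J₀ w₁ w₂ cⱼ g v z → v ∈ varSet I cⱼ := fun h => by
    rcases h.1 with e | e <;> rw [e] <;> exact vars_mem_varSet I cⱼ _
  have hprivᵢ : ∀ {g v z}, IsSwitch I J₀ w₁ w₂ cᵢ g v z → v ∈ bdry I J₀ := fun h => by
    rcases h.1 with e | e <;> rw [e]; exacts [hchᵢ.1, hchᵢ.2]
  -- for a gate on `cᵢ`'s pair and a gate on `cⱼ`'s pair: distinct gates, distinct partners, solutions with prescribed privates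
  have pair_facts : ∀ {g v z g' v' z'}, IsSwitch I J₀ w₁ w₂ cᵢ g v z → IsSwitch I J₀ w₁ w₂ cⱼ g' v' z' → g' ∈ w₁.2.1 ∪ w₂.2.1 →
      v' ≠ z ∧ z ≠ z' := by
    intro g v z g' v' z' h h' hg'
    have hvz : v' ≠ z := fun e => h.2.2.1 cⱼ hcⱼ (e ▸ hvmemⱼ h')
    have hzv : v ≠ z' := fun e => h'.2.2.1 cᵢ hcᵢ (e ▸ hvmemᵢ h)
    have hvv : v ≠ v' := fun e => not_mem_varSet_of_private I hcᵢ hcⱼ hne.symm (hprivᵢ h) (hvmemᵢ h) (e ▸ hvmemⱼ h')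
    have hgg : g' ≠ g := by
      intro e
      have hj := h'.2.1
      rw [e] at hj
      rcases h.2.1 with ⟨h2, h3⟩ | ⟨h2, h3⟩ <;> rcases hj with ⟨k2, k3⟩ | ⟨k2, k3⟩
      · exact hvv (h2.symm.trans k2)
      · exact hzv (h2.symm.trans k2)
      · exact hvz (k2.symm.trans h2)
      · exact hvv (h3.symm.trans k3)
    refine ⟨hvz, fun e => ?_⟩
    have hh := h.2.2.2 g' hg' hgg
    rcases h'.2.1 with ⟨-, k3⟩ | ⟨k2, -⟩
    · exact hh.2 (k3.trans e.symm)
    · exact hh.1 (k2.trans e.symm)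
  have hsol : ∀ {v v'}, (v = I.vars cᵢ 2 ∨ v = I.vars cᵢ 3) → (v' = I.vars cⱼ 2 ∨ v' = I.vars cⱼ 3) → ∀ s t : Bool,
      ∃ x : Fin n → Bool, (∀ j ∈ J₀, I.eval x j = y j) ∧ x v = s ∧ x v' = t := by
    intro v v' hv₁ hv₂ s t
    obtain ⟨πᵢ, κᵢ, hπᵢ⟩ := exists_slice hv₁ s
    obtain ⟨πⱼ, κⱼ, hπⱼ⟩ := exists_slice hv₂ t
    obtain ⟨x, hx, h2, h3, h2', h3'⟩ := exists_two_slices hI hcᵢ hcⱼ hne hchᵢ hchⱼ hv hgenᵢ πᵢ κᵢ πⱼ κⱼ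
    exact ⟨x, hx, hπᵢ x h2 h3, hπⱼ x h2' h3'⟩
  -- RANK ONE: any cross pair of gates with a non-vanishing move determinant kills
  by_cases H : ∃ g ∈ w₁.2.1 ∪ w₂.2.1, ∃ g' ∈ w₁.2.1 ∪ w₂.2.1, ∃ v z v' z', IsSwitch I J₀ w₁ w₂ cᵢ g v z ∧
      IsSwitch I J₀ w₁ w₂ cⱼ g' v' z' ∧ ∃ s t : Bool,
      ((xor (decide (z ∈ w₁.1)) (decide (g ∈ w₁.2.1) && s)) && (xor (decide (z' ∈ w₂.1)) (decide (g' ∈ w₂.2.1) && t))) ≠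
      ((xor (decide (z' ∈ w₁.1)) (decide (g' ∈ w₁.2.1) && t)) && (xor (decide (z ∈ w₂.1)) (decide (g ∈ w₂.2.1) && s)))
  · obtain ⟨g, hg, g', hg', v, z, v', z', h, h', s, t, hst⟩ := H
    obtain ⟨hvz, hzz⟩ := pair_facts h h' hg'
    obtain ⟨x, hx, hxs, hxt⟩ := hsol h.1 h'.1 s t
    have f₁ := flip_of_isSwitch hI hcᵢ h (subset_union_left (s₂ := w₂.2.1)) (C := w₁.1) x
    have f₂ := flip_of_isSwitch hI hcᵢ h (subset_union_right (s₁ := w₁.2.1)) (C := w₂.1) x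
    have f₁' := flip_of_isSwitch hI hcⱼ h' (subset_union_left (s₂ := w₂.2.1)) (C := w₁.1) x
    have f₂' := flip_of_isSwitch hI hcⱼ h' (subset_union_right (s₁ := w₁.2.1)) (C := w₂.1) x
    have d₁ := flip_of_isSwitch hI hcⱼ h' (subset_union_left (s₂ := w₂.2.1)) (C := w₁.1) (Function.update x z (!x z))
    have d₂ := flip_of_isSwitch hI hcⱼ h' (subset_union_right (s₁ := w₁.2.1)) (C := w₂.1) (Function.update x z (!x z))
    rw [hxs] at f₁ f₂
    rw [hxt] at f₁' f₂'
    rw [Function.update_of_ne hzz.symm, Function.update_of_ne hvz, f₁, hxt] at d₁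
    rw [Function.update_of_ne hzz.symm, Function.update_of_ne hvz, f₂, hxt] at d₂
    exact false_of_independent_switches ht h.2.2.1 h'.2.2.1 hx _ _ _ _ f₁ f₂ f₁' f₂' d₁ d₂ hst
  · push Not at H
    -- UNIFORM TYPE: every gate on either pair has the type of the fixed gate on the other pair
    have huniᵢ : ∀ g ∈ w₁.2.1 ∪ w₂.2.1, ∀ v z, IsSwitch I J₀ w₁ w₂ cᵢ g v z →
        decide (g ∈ w₁.2.1) = decide (gⱼ ∈ w₁.2.1) ∧ decide (g ∈ w₂.2.1) = decide (gⱼ ∈ w₂.2.1) ∧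
        ((decide (z ∈ w₁.1) = false ∧ decide (z ∈ w₂.1) = false) ∨
          (decide (z ∈ w₁.1) = decide (g ∈ w₁.2.1) ∧ decide (z ∈ w₂.1) = decide (g ∈ w₂.2.1))) := by
      intro g hg v z h
      have hl : (decide (g ∈ w₁.2.1) || decide (g ∈ w₂.2.1)) = true := by rcases mem_union.1 hg with e | e <;> simp [e]
      have hl' : (decide (gⱼ ∈ w₁.2.1) || decide (gⱼ ∈ w₂.2.1)) = true := by rcases mem_union.1 hgⱼ with e | e <;> simp [e]
      have Hg := H g hg gⱼ hgⱼ v z vⱼ zⱼ h hSⱼ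
      exact type_eq_of_det_zero _ _ _ _ _ _ _ _ ⟨by rw [hl, hl']; rfl, Hg false false, Hg false true, Hg true false, Hg true true⟩
    have huniⱼ : ∀ g' ∈ w₁.2.1 ∪ w₂.2.1, ∀ v' z', IsSwitch I J₀ w₁ w₂ cⱼ g' v' z' →
        decide (g' ∈ w₁.2.1) = decide (gᵢ ∈ w₁.2.1) ∧ decide (g' ∈ w₂.2.1) = decide (gᵢ ∈ w₂.2.1) ∧
        ((decide (z' ∈ w₁.1) = false ∧ decide (z' ∈ w₂.1) = false) ∨
          (decide (z' ∈ w₁.1) = decide (g' ∈ w₁.2.1) ∧ decide (z' ∈ w₂.1) = decide (g' ∈ w₂.2.1))) := by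
      intro g' hg' v' z' h'
      have hl : (decide (g' ∈ w₁.2.1) || decide (g' ∈ w₂.2.1)) = true := by rcases mem_union.1 hg' with e | e <;> simp [e]
      have hl' : (decide (gᵢ ∈ w₁.2.1) || decide (gᵢ ∈ w₂.2.1)) = true := by rcases mem_union.1 hgᵢ with e | e <;> simp [e]
      have Hg := H gᵢ hgᵢ g' hg' vᵢ zᵢ v' z' hSᵢ h'
      -- the determinant is symmetric under exchanging the two gates together with `(s, t)`
      have Hg' : ∀ s t : Bool,
          ((xor (decide (z' ∈ w₁.1)) (decide (g' ∈ w₁.2.1) && s)) && (xor (decide (zᵢ ∈ w₂.1)) (decide (gᵢ ∈ w₂.2.1) && t))) =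
          ((xor (decide (zᵢ ∈ w₁.1)) (decide (gᵢ ∈ w₁.2.1) && t)) && (xor (decide (z' ∈ w₂.1)) (decide (g' ∈ w₂.2.1) && s))) :=
        fun s t => (Hg t s).symm
      exact type_eq_of_det_zero _ _ _ _ _ _ _ _ ⟨by rw [hl, hl']; rfl, Hg' false false, Hg' false true, Hg' true false, Hg' true true⟩
    -- the common type, read off the two fixed gates
    obtain ⟨hl₁, hl₂, -⟩ := huniᵢ gᵢ hgᵢ vᵢ zᵢ hSᵢ
    -- every monomial touching a pair has the common type; partners follow their gate
    have memᵢ : ∀ g ∈ w₁.2.1 ∪ w₂.2.1, Touches I cᵢ g →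
        (g ∈ w₁.2.1 ↔ gⱼ ∈ w₁.2.1) ∧ (g ∈ w₂.2.1 ↔ gⱼ ∈ w₂.2.1) := by
      intro g hg htg
      obtain ⟨v, z, h⟩ := hallᵢ g hg htg
      obtain ⟨k₁, k₂, -⟩ := huniᵢ g hg v z h
      exact ⟨(decide_eq_decide.1 k₁), (decide_eq_decide.1 k₂)⟩
    have memⱼ : ∀ g' ∈ w₁.2.1 ∪ w₂.2.1, Touches I cⱼ g' →
        (g' ∈ w₁.2.1 ↔ gⱼ ∈ w₁.2.1) ∧ (g' ∈ w₂.2.1 ↔ gⱼ ∈ w₂.2.1) := by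
      intro g' hg' htg
      obtain ⟨v', z', h'⟩ := hallⱼ g' hg' htg
      obtain ⟨k₁, k₂, -⟩ := huniⱼ g' hg' v' z' h'
      exact ⟨(decide_eq_decide.1 k₁).trans (decide_eq_decide.1 hl₁), (decide_eq_decide.1 k₂).trans (decide_eq_decide.1 hl₂)⟩
    -- readers not containing a gate avoid the pair / the partner
    have avoid_pair : ∀ {c : Fin m} {G : Finset (Fin m)}, G ⊆ w₁.2.1 ∪ w₂.2.1 → (∀ g ∈ G, ¬ Touches I c g) →
        ∀ g ∈ G, (I.vars g 2 ≠ I.vars c 2 ∧ I.vars g 3 ≠ I.vars c 2) ∧ (I.vars g 2 ≠ I.vars c 3 ∧ I.vars g 3 ≠ I.vars c 3) :=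
      fun hG h g hg => not_not.1 (h g hg)
    have avoid_z : ∀ {c g : Fin m} {v z : Fin n} {G : Finset (Fin m)}, IsSwitch I J₀ w₁ w₂ c g v z → G ⊆ w₁.2.1 ∪ w₂.2.1 → g ∉ G →
        ∀ g' ∈ G, I.vars g' 2 ≠ z ∧ I.vars g' 3 ≠ z :=
      fun h hG hg g' hg' => h.2.2.2 g' (hG hg') (fun e => hg (e ▸ hg'))
    -- case analysis on the common type `(λ₁, λ₂) = ([gⱼ ∈ G₁], [gⱼ ∈ G₂])`
    by_cases hG₁ : gⱼ ∈ w₁.2.1 <;> by_cases hG₂ : gⱼ ∈ w₂.2.1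
    · -- TYPE III
      have ntᵢ : ∀ g ∈ w₁.2.1 ∆ w₂.2.1, ¬ Touches I cᵢ g := fun g hg htg => by
        have hm := memᵢ g (symmDiff_subset_union' _ _ hg) htg
        rcases Finset.mem_symmDiff.1 hg with ⟨h1, h2⟩ | ⟨h2, h1⟩
        · exact h2 (hm.2.2 hG₂)
        · exact h1 (hm.1.2 hG₁)
      have ntⱼ : ∀ g ∈ w₁.2.1 ∆ w₂.2.1, ¬ Touches I cⱼ g := fun g hg htg => by
        have hm := memⱼ g (symmDiff_subset_union' _ _ hg) htg
        rcases Finset.mem_symmDiff.1 hg with ⟨h1, h2⟩ | ⟨h2, h1⟩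
        · exact h2 (hm.2.2 hG₂)
        · exact h1 (hm.1.2 hG₁)
      obtain ⟨πᵢ, κᵢ, hπᵢ⟩ := exists_slice hSᵢ.1 (!decide (zᵢ ∈ w₁.1))
      obtain ⟨πⱼ, κⱼ, hπⱼ⟩ := exists_slice hSⱼ.1 (!decide (zⱼ ∈ w₁.1))
      have hgᵢ₁ : gᵢ ∈ w₁.2.1 := (memᵢ gᵢ hgᵢ htᵢ).1.2 hG₁
      have hgᵢ₂ : gᵢ ∈ w₂.2.1 := (memᵢ gᵢ hgᵢ htᵢ).2.2 hG₂
      obtain ⟨-, -, heᵢ⟩ := huniᵢ gᵢ hgᵢ vᵢ zᵢ hSᵢ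
      obtain ⟨-, -, heⱼ⟩ := huniⱼ gⱼ hgⱼ vⱼ zⱼ hSⱼ
      have ezᵢ : decide (zᵢ ∈ w₂.1) = decide (zᵢ ∈ w₁.1) := by
        rcases heᵢ with ⟨a, b⟩ | ⟨a, b⟩
        · rw [a, b]
        · rw [a, b, decide_eq_true hgᵢ₁, decide_eq_true hgᵢ₂]
      have ezⱼ : decide (zⱼ ∈ w₂.1) = decide (zⱼ ∈ w₁.1) := by
        rcases heⱼ with ⟨a, b⟩ | ⟨a, b⟩
        · rw [a, b]
        · rw [a, b, decide_eq_true hG₁, decide_eq_true hG₂]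
      refine false_of_typeIII hI hT hS hB ht hcᵢ hcⱼ hne hchᵢ hchⱼ hv (avoid_pair (symmDiff_subset_union' _ _) ntᵢ)
        (avoid_pair (symmDiff_subset_union' _ _) ntⱼ) (sliceGeneric_mono (symmDiff_subset_union' _ _) hgenᵢ)
        (sliceGeneric_mono (symmDiff_subset_union' _ _) hgenⱼ) hSᵢ.2.2.1 hSⱼ.2.2.1 πᵢ κᵢ πⱼ κⱼ
        (fun x hx hp hq => ⟨?_, ?_⟩) (fun x hx hp hq => ⟨?_, ?_⟩)
      · rw [flip_of_isSwitch hI hcᵢ hSᵢ subset_union_left x, hπᵢ x hp hq, decide_eq_true hgᵢ₁]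
        cases gval I w₁.1 w₁.2.1 x <;> cases decide (zᵢ ∈ w₁.1) <;> decide
      · rw [flip_of_isSwitch hI hcᵢ hSᵢ subset_union_right x, hπᵢ x hp hq, decide_eq_true hgᵢ₂, ezᵢ]
        cases gval I w₂.1 w₂.2.1 x <;> cases decide (zᵢ ∈ w₁.1) <;> decide
      · rw [flip_of_isSwitch hI hcⱼ hSⱼ subset_union_left x, hπⱼ x hp hq, decide_eq_true hG₁]
        cases gval I w₁.1 w₁.2.1 x <;> cases decide (zⱼ ∈ w₁.1) <;> decide
      · rw [flip_of_isSwitch hI hcⱼ hSⱼ subset_union_right x, hπⱼ x hp hq, decide_eq_true hG₂, ezⱼ]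
        cases gval I w₂.1 w₂.2.1 x <;> cases decide (zⱼ ∈ w₁.1) <;> decide
    · -- TYPE I: no monomial touching either pair lies in `G₂`; partners invisible to `Γ₂`
      have ntᵢ : ∀ g ∈ w₂.2.1, ¬ Touches I cᵢ g := fun g hg htg => hG₂ ((memᵢ g (mem_union_right _ hg) htg).2.1 hg)
      have ntⱼ : ∀ g ∈ w₂.2.1, ¬ Touches I cⱼ g := fun g hg htg => hG₂ ((memⱼ g (mem_union_right _ hg) htg).2.1 hg)
      have hgᵢ₁ : gᵢ ∈ w₁.2.1 := (memᵢ gᵢ hgᵢ htᵢ).1.2 hG₁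
      have hgᵢ₂ : gᵢ ∉ w₂.2.1 := fun h => hG₂ ((memᵢ gᵢ hgᵢ htᵢ).2.1 h)
      obtain ⟨-, -, heᵢ⟩ := huniᵢ gᵢ hgᵢ vᵢ zᵢ hSᵢ
      obtain ⟨-, -, heⱼ⟩ := huniⱼ gⱼ hgⱼ vⱼ zⱼ hSⱼ
      have ezᵢ : zᵢ ∉ w₂.1 := by
        rcases heᵢ with ⟨-, b⟩ | ⟨-, b⟩
        · exact of_decide_eq_false b
        · exact fun h => hgᵢ₂ (of_decide_eq_true (b ▸ decide_eq_true h))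
      have ezⱼ : zⱼ ∉ w₂.1 := by
        rcases heⱼ with ⟨-, b⟩ | ⟨-, b⟩
        · exact of_decide_eq_false b
        · exact fun h => hG₂ (of_decide_eq_true (b ▸ decide_eq_true h))
      obtain ⟨πᵢ, κᵢ, hπᵢ⟩ := exists_slice hSᵢ.1 (!decide (zᵢ ∈ w₁.1))
      obtain ⟨πⱼ, κⱼ, hπⱼ⟩ := exists_slice hSⱼ.1 (!decide (zⱼ ∈ w₁.1))
      refine false_of_typeI hI hT hS hB ht hcᵢ hcⱼ hne hchᵢ hchⱼ hv (avoid_pair subset_union_right ntᵢ)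
        (avoid_pair subset_union_right ntⱼ) (sliceGeneric_mono subset_union_right hgenᵢ) (sliceGeneric_mono subset_union_right hgenⱼ)
        hSᵢ.2.2.1 ezᵢ (avoid_z hSᵢ subset_union_right hgᵢ₂) hSⱼ.2.2.1 ezⱼ (avoid_z hSⱼ subset_union_right hG₂) πᵢ κᵢ πⱼ κⱼ
        (fun x hx hp hq => ?_) (fun x hx hp hq => ?_)
      · rw [flip_of_isSwitch hI hcᵢ hSᵢ subset_union_left x, hπᵢ x hp hq, decide_eq_true hgᵢ₁]
        cases gval I w₁.1 w₁.2.1 x <;> cases decide (zᵢ ∈ w₁.1) <;> decide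
      · rw [flip_of_isSwitch hI hcⱼ hSⱼ subset_union_left x, hπⱼ x hp hq, decide_eq_true hG₁]
        cases gval I w₁.1 w₁.2.1 x <;> cases decide (zⱼ ∈ w₁.1) <;> decide
    · -- TYPE II: no monomial touching either pair lies in `G₁`; partners invisible to `Γ₁`
      have ntᵢ : ∀ g ∈ w₁.2.1, ¬ Touches I cᵢ g := fun g hg htg => hG₁ ((memᵢ g (mem_union_left _ hg) htg).1.1 hg)
      have ntⱼ : ∀ g ∈ w₁.2.1, ¬ Touches I cⱼ g := fun g hg htg => hG₁ ((memⱼ g (mem_union_left _ hg) htg).1.1 hg)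
      have hgᵢ₂ : gᵢ ∈ w₂.2.1 := (memᵢ gᵢ hgᵢ htᵢ).2.2 hG₂
      have hgᵢ₁ : gᵢ ∉ w₁.2.1 := fun h => hG₁ ((memᵢ gᵢ hgᵢ htᵢ).1.1 h)
      obtain ⟨-, -, heᵢ⟩ := huniᵢ gᵢ hgᵢ vᵢ zᵢ hSᵢ
      obtain ⟨-, -, heⱼ⟩ := huniⱼ gⱼ hgⱼ vⱼ zⱼ hSⱼ
      have ezᵢ : zᵢ ∉ w₁.1 := by
        rcases heᵢ with ⟨a, -⟩ | ⟨a, -⟩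
        · exact of_decide_eq_false a
        · exact fun h => hgᵢ₁ (of_decide_eq_true (a ▸ decide_eq_true h))
      have ezⱼ : zⱼ ∉ w₁.1 := by
        rcases heⱼ with ⟨a, -⟩ | ⟨a, -⟩
        · exact of_decide_eq_false a
        · exact fun h => hG₁ (of_decide_eq_true (a ▸ decide_eq_true h))
      obtain ⟨πᵢ, κᵢ, hπᵢ⟩ := exists_slice hSᵢ.1 (!decide (zᵢ ∈ w₂.1))
      obtain ⟨πⱼ, κⱼ, hπⱼ⟩ := exists_slice hSⱼ.1 (!decide (zⱼ ∈ w₂.1))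
      refine false_of_typeII hI hT hS hB ht hcᵢ hcⱼ hne hchᵢ hchⱼ hv (avoid_pair subset_union_left ntᵢ)
        (avoid_pair subset_union_left ntⱼ) (sliceGeneric_mono subset_union_left hgenᵢ) (sliceGeneric_mono subset_union_left hgenⱼ)
        hSᵢ.2.2.1 ezᵢ (avoid_z hSᵢ subset_union_left hgᵢ₁) hSⱼ.2.2.1 ezⱼ (avoid_z hSⱼ subset_union_left hG₁) πᵢ κᵢ πⱼ κⱼ
        (fun x hx hp hq => ?_) (fun x hx hp hq => ?_)
      · rw [flip_of_isSwitch hI hcᵢ hSᵢ subset_union_right x, hπᵢ x hp hq, decide_eq_true hgᵢ₂]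
        cases gval I w₂.1 w₂.2.1 x <;> cases decide (zᵢ ∈ w₂.1) <;> decide
      · rw [flip_of_isSwitch hI hcⱼ hSⱼ subset_union_right x, hπⱼ x hp hq, decide_eq_true hG₂]
        cases gval I w₂.1 w₂.2.1 x <;> cases decide (zⱼ ∈ w₂.1) <;> decide
    · -- no type: the fixed gate `gⱼ` lies in neither reader
      rcases mem_union.1 hgⱼ with h | h
      · exact hG₁ h
      · exact hG₂ h

end Main

end Summit.PneNP.PneNP.Theorems.PstarChordReadSwitches
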